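import Literature.Barriers.QuantumFields.FreeTwoPointContinuation
import Literature.MathematicalPhysics.QuantumLattice.FreeCovarianceTimeSeparatedProofs
import Mathlib.MeasureTheory.Integral.Pi
import HarnessLib

/-!
# The Euclidean values of the free holomorphic two-point function are the free covariance

Sibling proof file of `FreeTwoPointContinuation.lean` (theorems only): the Euclidean restriction
of the holomorphic free two-point function, smeared with two test functions of *gapped*
time-separated supports (`supp f ⊆ {x⁰ < c₁}`, `supp g ⊆ {x⁰ > c₂}`, `c₁ < c₂`) with `f` real,
is the free covariance:
`∫ 𝔚(ιx) f(x₀) g(x₁) dx = C_m(f, g)` (`integral_freeTwoPointWightmanHol_euclideanPoint_eq`).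
The left-hand side is expanded with `freeTwoPointWightmanHol_euclideanPoint`, the momentum integral
exchanged with the configuration integral (Fubini: with the gap `c₂ − c₁ > 0` the Euclidean kernel
is bounded by `(2|m|)⁻¹ e^{−2π(c₂−c₁)‖ξ⃗‖}`), the configuration integral factorised, and the result
matched with the momentum form of the free covariance on time-separated test functions
(`freeCovariance_eq_of_timeSeparated`, Glimm–Jaffe (6.2.15)) after the substitution `η = −ξ⃗`
(`ω(η) = 2π E_m(ξ⃗)`). This is the Osterwalder–Schrader relation `S₂ = 𝔚₂ ∘ ι` for the free
field, Glimm–Jaffe (6.1.17)/(6.2.9).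

## References

* J. Glimm, A. Jaffe, *Quantum Physics* (2nd ed. 1987), §6.1 (6.1.17), §6.2 (6.2.9)
  "analytic continuation `x₀ → ix₀` leads to the formula `S₂(x) = ∫ e^{ipx} (p² + m²)⁻¹`",
  Prop. 6.2.5 / (6.2.15) (pdf pp. 92, 96–97). [GlimmJaffeQP1987]
-/

noncomputable section

open MeasureTheory Complex Real
open scoped InnerProductSpace SchwartzMap ComplexConjugate FourierTransform

namespace Literature.Barriers.QuantumFields

open Literature.MathematicalPhysics.QuantumLattice

variable {d : ℕ}

/-! ### Momentum bookkeeping: `ω(−ξ⃗) = 2π E_m(ξ⃗)` and the phases -/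

/-- `√((2π)² Σⱼ ξⱼ² + m²) = 2π E_m(ξ⃗)`. [folklore] -/
theorem sqrt_sum_sq_eq_two_pi_mul_shellEnergy (m : ℝ) (ξ : EuclideanSpace ℝ (Fin d)) :
    √((2 * π) ^ 2 * ∑ j : Fin d, (-(WithLp.ofLp ξ j)) ^ 2 + m ^ 2) = 2 * π * shellEnergy d m ξ := by
  have hsum : ∑ j : Fin d, (-(WithLp.ofLp ξ j)) ^ 2 = ‖ξ‖ ^ 2 := by
    rw [EuclideanSpace.real_norm_sq_eq]
    exact Finset.sum_congr rfl fun j _ => by rw [neg_sq]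
  have hE : 0 ≤ shellEnergy d m ξ := Real.sqrt_nonneg _
  rw [hsum, show 2 * π * shellEnergy d m ξ = √((2 * π * shellEnergy d m ξ) ^ 2) from
    (Real.sqrt_sq (by positivity)).symm]
  congr 1
  rw [mul_pow (2 * π) (shellEnergy d m ξ) 2, shellEnergy_sq]
  field_simp

/-- `Σⱼ y_{j+1} (−ξⱼ) = −⟪ξ⃗, y⃗⟫`. [folklore] -/
theorem sum_mul_neg_eq_neg_inner (ξ : EuclideanSpace ℝ (Fin d))
    (y : EuclideanSpace ℝ (Fin (d + 1))) :
    ∑ j : Fin d, y j.succ * (-(WithLp.ofLp ξ j)) = -⟪ξ, spaceC d y⟫_ℝ := by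
  rw [PiLp.inner_apply, ← Finset.sum_neg_distrib]
  refine Finset.sum_congr rfl fun j _ => ?_
  simp only [spaceC_apply, RCLike.inner_apply, conj_trivial]
  show y j.succ * -(ξ j) = -(y j.succ * ξ j)
  ring

/-! ### Integrability for Fubini -/

/-- The two-point test function `f(x₀) g(x₁)` is integrable on `(ℝ^{d+1})²`. [folklore] -/
theorem integrable_tensor_two (f g : 𝓢(EuclideanSpace ℝ (Fin (d + 1)), ℂ)) :
    Integrable fun x : Fin 2 → EuclideanSpace ℝ (Fin (d + 1)) => f (x 0) * g (x 1) := by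
  have h := Integrable.fintype_prod (ι := Fin 2) (μ := fun _ => volume)
    (f := fun i => ((![f, g] : Fin 2 → 𝓢(EuclideanSpace ℝ (Fin (d + 1)), ℂ)) i :
      EuclideanSpace ℝ (Fin (d + 1)) → ℂ)) fun i => by
      fin_cases i <;> exact SchwartzMap.integrable _
  refine h.congr (ae_of_all _ fun x => ?_)
  simp only [Fin.prod_univ_two, Matrix.cons_val_zero, Matrix.cons_val_one]

/-- **The key pointwise bound.** On the supports (`x₀⁰ < c₁`, `x₁⁰ > c₂`) the Euclidean kernel
integrand is exponentially small: with the gap `τ = x₁⁰ − x₀⁰ > c₂ − c₁ > 0`,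
`(4πE)⁻¹ e^{−2πEτ} ≤ (2|m|)⁻¹ e^{−2π(c₂−c₁)‖ξ⃗‖}`. [folklore] -/
theorem norm_euclidean_integrand_le {m : ℝ} (hm : m ≠ 0) {c₁ c₂ : ℝ} (hc : c₁ < c₂)
    (ξ : EuclideanSpace ℝ (Fin d)) {t₀ t₁ : ℝ} (h₀ : t₀ < c₁) (h₁ : c₂ < t₁) (r : ℝ) :
    ‖((4 * π * shellEnergy d m ξ)⁻¹ : ℝ) •
        ((rexp (-(2 * π * shellEnergy d m ξ * (t₁ - t₀))) : ℂ) * (𝐞 r : ℂ))‖ ≤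
      (4 * π * (|m| / (2 * π)))⁻¹ * rexp (-(2 * π * (c₂ - c₁) * ‖ξ‖)) := by
  have hE := shellEnergy_pos d hm ξ
  have hEξ : ‖ξ‖ ≤ shellEnergy d m ξ := by
    unfold shellEnergy
    calc ‖ξ‖ = Real.sqrt (‖ξ‖ ^ 2) := (Real.sqrt_sq (norm_nonneg _)).symm
      _ ≤ Real.sqrt (‖ξ‖ ^ 2 + (m / (2 * π)) ^ 2) := Real.sqrt_le_sqrt (by nlinarith)
  have hEm : |m| / (2 * π) ≤ shellEnergy d m ξ := by
    unfold shellEnergy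
    calc |m| / (2 * π) = Real.sqrt ((m / (2 * π)) ^ 2) := by
          rw [Real.sqrt_sq_eq_abs, abs_div, abs_of_pos (by positivity : (0 : ℝ) < 2 * π)]
      _ ≤ Real.sqrt (‖ξ‖ ^ 2 + (m / (2 * π)) ^ 2) := Real.sqrt_le_sqrt (by nlinarith)
  rw [norm_smul, norm_mul, Circle.norm_coe, mul_one, Complex.norm_real, Real.norm_of_nonneg
    (Real.exp_pos _).le, Real.norm_of_nonneg (by positivity)]
  have hm' : 0 < |m| / (2 * π) := by positivity
  refine mul_le_mul ?_ ?_ (by positivity) (by positivity)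
  · exact inv_anti₀ (by positivity) (by nlinarith [Real.pi_pos])
  · refine Real.exp_le_exp.2 ?_
    have h1 : ‖ξ‖ * (c₂ - c₁) ≤ shellEnergy d m ξ * (t₁ - t₀) :=
      mul_le_mul hEξ (by linarith) (by linarith) hE.le
    nlinarith [Real.pi_pos]

/-! ### The Euclidean identification -/

/-- **The Euclidean values of the free holomorphic two-point function give the free covariance**
(Glimm–Jaffe (6.1.17) with (6.2.9) for the free field, smeared): for `m ≠ 0`, a real test
function `f` and a test function `g` with gapped time-separated supports
`supp f ⊆ {x⁰ < c₁}`, `supp g ⊆ {x⁰ > c₂}`, `c₁ < c₂`,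
`∫ 𝔚(ιx) f(x₀) g(x₁) dx = C_m(f, g)`. Proof: expand `𝔚(ιx)` as the momentum integral of
`(4πE)⁻¹ e^{−2πE(x₁⁰−x₀⁰)} 𝐞(⟪ξ⃗, x⃗₁ − x⃗₀⟫)` (`freeTwoPointWightmanHol_euclideanPoint`), exchange
the integrals (the gap makes the kernel bounded by `(2|m|)⁻¹ e^{−2π(c₂−c₁)‖ξ⃗‖}`, integrable against
`|f(x₀)| |g(x₁)|`), factorise the configuration integral, and compare with the momentum form of
`C_m` on time-separated test functions (`freeCovariance_eq_of_timeSeparated`) at `η = −ξ⃗`, where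
`ω(η) = 2πE_m(ξ⃗)`. [cite: GlimmJaffeQP1987, §6.2 (6.2.9) with Prop 6.2.5] -/
theorem integral_freeTwoPointWightmanHol_euclideanPoint_eq {m : ℝ} (hm : m ≠ 0)
    {f g : 𝓢(EuclideanSpace ℝ (Fin (d + 1)), ℂ)} {c₁ c₂ : ℝ} (hc : c₁ < c₂)
    (hf : tsupport (f : EuclideanSpace ℝ (Fin (d + 1)) → ℂ) ⊆ {y | y 0 < c₁})
    (hg : tsupport (g : EuclideanSpace ℝ (Fin (d + 1)) → ℂ) ⊆ {x | c₂ < x 0})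
    (hfreal : ∀ y, conj (f y) = f y) :
    ∫ x : Fin 2 → EuclideanSpace ℝ (Fin (d + 1)),
        freeTwoPointWightmanHol d m (euclideanPoint x) * (f (x 0) * g (x 1)) =
      freeCovariance m f g := by
  -- notation: `E = E_m(ξ)`, the weights and phases
  set A : EuclideanSpace ℝ (Fin d) → EuclideanSpace ℝ (Fin (d + 1)) → ℂ :=
    fun ξ y => (𝐞 (-⟪ξ, spaceC d y⟫_ℝ) : ℂ) * (rexp (2 * π * shellEnergy d m ξ * y 0) : ℂ) * f y
    with hA
  set B : EuclideanSpace ℝ (Fin d) → EuclideanSpace ℝ (Fin (d + 1)) → ℂ :=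
    fun ξ x => (𝐞 (⟪ξ, spaceC d x⟫_ℝ) : ℂ) * (rexp (-(2 * π * shellEnergy d m ξ * x 0)) : ℂ) * g x
    with hB
  set Φ : EuclideanSpace ℝ (Fin d) → (Fin 2 → EuclideanSpace ℝ (Fin (d + 1))) → ℂ :=
    fun ξ x => ((4 * π * shellEnergy d m ξ)⁻¹ : ℝ) •
      ((rexp (-(2 * π * shellEnergy d m ξ * (x 1 0 - x 0 0))) : ℂ) *
        (𝐞 (⟪ξ, spaceC d (x 1) - spaceC d (x 0)⟫_ℝ) : ℂ)) with hΦ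
  -- Step 1: the integrand as a momentum integral, then Fubini
  have h1 : ∀ x : Fin 2 → EuclideanSpace ℝ (Fin (d + 1)),
      freeTwoPointWightmanHol d m (euclideanPoint x) * (f (x 0) * g (x 1)) =
        ∫ ξ, Φ ξ x * (f (x 0) * g (x 1)) := by
    intro x
    rw [freeTwoPointWightmanHol_euclideanPoint, ← integral_mul_const]
  simp_rw [h1]
  -- integrability of `(x, ξ) ↦ Φ ξ x f(x₀) g(x₁)`
  have hΦc : Continuous fun p : (Fin 2 → EuclideanSpace ℝ (Fin (d + 1))) × EuclideanSpace ℝ (Fin d) =>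
      Φ p.2 p.1 * (f (p.1 0) * g (p.1 1)) := by
    have hE : Continuous fun p : (Fin 2 → EuclideanSpace ℝ (Fin (d + 1))) ×
        EuclideanSpace ℝ (Fin d) => shellEnergy d m p.2 :=
      (continuous_shellEnergy m).comp continuous_snd
    have hEpos : ∀ p : (Fin 2 → EuclideanSpace ℝ (Fin (d + 1))) × EuclideanSpace ℝ (Fin d),
        4 * π * shellEnergy d m p.2 ≠ 0 := fun p =>
      (mul_pos (by positivity) (shellEnergy_pos d hm p.2)).ne'
    simp only [hΦ]
    refine ((((continuous_const.mul hE).inv₀ hEpos).smul ?_).mul (by fun_prop))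
    refine (Complex.continuous_ofReal.comp (Real.continuous_exp.comp ?_)).mul ?_
    · fun_prop
    · exact (continuous_fourierChar_coe).comp (by fun_prop)
  have hbound : ∀ (x : Fin 2 → EuclideanSpace ℝ (Fin (d + 1))) (ξ : EuclideanSpace ℝ (Fin d)),
      ‖Φ ξ x * (f (x 0) * g (x 1))‖ ≤
        ((4 * π * (|m| / (2 * π)))⁻¹ * rexp (-(2 * π * (c₂ - c₁) * ‖ξ‖))) *
          (‖f (x 0)‖ * ‖g (x 1)‖) := by
    intro x ξ
    by_cases hx : f (x 0) * g (x 1) = 0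
    · rw [hx, mul_zero, norm_zero]
      positivity
    · have hf0 : f (x 0) ≠ 0 := left_ne_zero_of_mul hx
      have hg0 : g (x 1) ≠ 0 := right_ne_zero_of_mul hx
      have ht₀ : x 0 0 < c₁ := hf (subset_tsupport _ (Function.mem_support.2 hf0))
      have ht₁ : c₂ < x 1 0 := hg (subset_tsupport _ (Function.mem_support.2 hg0))
      rw [norm_mul, norm_mul]
      exact mul_le_mul_of_nonneg_right (norm_euclidean_integrand_le hm hc ξ ht₀ ht₁ _)
        (by positivity)
  have hint : Integrable (fun p : (Fin 2 → EuclideanSpace ℝ (Fin (d + 1))) × EuclideanSpace ℝ (Fin d) =>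
      Φ p.2 p.1 * (f (p.1 0) * g (p.1 1))) (volume.prod volume) := by
    refine Integrable.mono' ?_ hΦc.aestronglyMeasurable (ae_of_all _ fun p => hbound p.1 p.2)
    have hx : Integrable fun x : Fin 2 → EuclideanSpace ℝ (Fin (d + 1)) => ‖f (x 0)‖ * ‖g (x 1)‖ := by
      have := (integrable_tensor_two f g).norm
      simpa only [norm_mul] using this
    have hξ : Integrable fun ξ : EuclideanSpace ℝ (Fin d) =>
        (4 * π * (|m| / (2 * π)))⁻¹ * rexp (-(2 * π * (c₂ - c₁) * ‖ξ‖)) := by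
      have := (integrable_one_add_norm_pow_mul_exp_neg (d := d) (β := 2 * π * (c₂ - c₁))
        (by nlinarith [Real.pi_pos]) 0).const_mul (4 * π * (|m| / (2 * π)))⁻¹
      refine this.congr (ae_of_all _ fun ξ => ?_)
      simp only [pow_zero, one_mul]
    have := hx.mul_prod hξ
    refine this.congr (ae_of_all _ fun p => ?_)
    simp only
    ring
  rw [integral_integral_swap hint]
  -- Step 2: factorise the configuration integral at fixed `ξ`
  have h2 : ∀ ξ : EuclideanSpace ℝ (Fin d),
      ∫ x : Fin 2 → EuclideanSpace ℝ (Fin (d + 1)), Φ ξ x * (f (x 0) * g (x 1)) =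
        (((4 * π * shellEnergy d m ξ)⁻¹ : ℝ) : ℂ) * ((∫ y, A ξ y) * ∫ x, B ξ x) := by
    intro ξ
    have hpt : ∀ x : Fin 2 → EuclideanSpace ℝ (Fin (d + 1)), Φ ξ x * (f (x 0) * g (x 1)) =
        (((4 * π * shellEnergy d m ξ)⁻¹ : ℝ) : ℂ) * (A ξ (x 0) * B ξ (x 1)) := by
      intro x
      simp only [hΦ, hA, hB, Complex.real_smul]
      rw [show ⟪ξ, spaceC d (x 1) - spaceC d (x 0)⟫_ℝ = ⟪ξ, spaceC d (x 1)⟫_ℝ + -⟪ξ, spaceC d (x 0)⟫_ℝ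
        by rw [inner_sub_right, sub_eq_add_neg], fourierChar_coe_add,
        show -(2 * π * shellEnergy d m ξ * (x 1 0 - x 0 0)) =
          2 * π * shellEnergy d m ξ * x 0 0 + -(2 * π * shellEnergy d m ξ * x 1 0) by ring,
        Real.exp_add]
      push_cast
      ring
    simp_rw [hpt]
    rw [integral_const_mul]
    congr 1
    have hprod := integral_fintype_prod_volume_eq_prod (ι := Fin 2)
      (E := fun _ => EuclideanSpace ℝ (Fin (d + 1)))
      (fun i => ((![A ξ, B ξ] : Fin 2 → EuclideanSpace ℝ (Fin (d + 1)) → ℂ)) i)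
    simp only [Fin.prod_univ_two, Matrix.cons_val_zero, Matrix.cons_val_one] at hprod
    exact hprod
  simp_rw [h2]
  -- Step 3: the free covariance in momentum form, reflected `η ↦ −η` and moved to `EuclideanSpace`
  have hg' : tsupport (g : EuclideanSpace ℝ (Fin (d + 1)) → ℂ) ⊆ {x | c₁ < x 0} :=
    hg.trans fun x hx => lt_trans hc hx
  rw [freeCovariance_eq_of_timeSeparated hm hf hg']
  -- reflect `η ↦ −η` and move the (left-hand) momentum integral to `Fin d → ℝ` along `toLp`
  rw [← integral_neg_eq_self]
  rw [← (PiLp.volume_preserving_toLp (Fin d)).integral_comp'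
    (f := MeasurableEquiv.toLp 2 (Fin d → ℝ))]
  congr 1
  funext ξ
  -- pointwise identification: both sides at `ξ' = −toLp ξ`
  set ξ' : EuclideanSpace ℝ (Fin d) := -(MeasurableEquiv.toLp 2 (Fin d → ℝ) ξ) with hξ'
  have hcoord : ∀ j : Fin d, ξ j = -(WithLp.ofLp ξ' j) := by
    intro j
    simp only [hξ', MeasurableEquiv.toLp_apply, WithLp.ofLp_neg, Pi.neg_apply, neg_neg]
  have hsumsq : ∑ j : Fin d, ξ j ^ 2 = ∑ j : Fin d, (-(WithLp.ofLp ξ' j)) ^ 2 :=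
    Finset.sum_congr rfl fun j _ => by rw [hcoord]
  have hphase : ∀ y : EuclideanSpace ℝ (Fin (d + 1)),
      ∑ j : Fin d, y j.succ * ξ j = -⟪ξ', spaceC d y⟫_ℝ := by
    intro y
    rw [← sum_mul_neg_eq_neg_inner ξ' y]
    exact Finset.sum_congr rfl fun j _ => by rw [hcoord]
  rw [hsumsq, sqrt_sum_sq_eq_two_pi_mul_shellEnergy m ξ']
  simp only [hphase, neg_neg]
  -- the conjugated factor: `conj (∫ 𝐞(⟪ξ', y⃗⟫) e^{ω y⁰} f y) = ∫ 𝐞(−⟪ξ', y⃗⟫) e^{ω y⁰} f y` (f real)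
  have hconj : conj (∫ y : EuclideanSpace ℝ (Fin (d + 1)), (𝐞 (⟪ξ', spaceC d y⟫_ℝ) : ℂ) *
      (rexp (2 * π * shellEnergy d m ξ' * y 0) : ℂ) * f y) = ∫ y, A ξ' y := by
    rw [← integral_conj]
    congr 1
    funext y
    simp only [hA, map_mul, Circle.starRingEnd_addChar, Complex.conj_ofReal, hfreal y]
  rw [hconj]
  have hBeq : (∫ x : EuclideanSpace ℝ (Fin (d + 1)), (𝐞 (⟪ξ', spaceC d x⟫_ℝ) : ℂ) *
      (rexp (-(2 * π * shellEnergy d m ξ' * x 0)) : ℂ) * g x) = ∫ x, B ξ' x := rfl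
  rw [hBeq]
  congr 1
  push_cast
  ring

end Literature.Barriers.QuantumFields
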